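import Literature.NumberTheory.Automorphic.LocalHermitianPlaneAnisotropic
import Literature.NumberTheory.Automorphic.Liu2021.LemD1IsotropyOfPlace
import Literature.NumberTheory.Rogawski1990.KottwitzSteinbergRankTwo
import Literature.NumberTheory.Automorphic.UnitaryConjClassClosed
import HarnessLib

/-!
# Binary hermitian forms with LOCAL coefficients: two non-degenerate hermitian planes over `E_v` (non-split `v`) are congruent
# iff their determinants agree modulo norms (Jacobowitz's rank-2 classification)

(Jacobowitz, *Hermitian forms over local fields*, Amer. J. Math. 84 (1962), §3 Thm. 3.1; Scharlau, *Quadratic and Hermitian Forms*,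
Ch. 10 §1; Jacobson 1940 (hermitian forms over `𝔭`-adic fields are universal in `≥ 2` variables).)

Topic `NumberTheory/Automorphic`; namespace `Literature.NumberTheory.Automorphic.UnitaryGroup`.  THEOREMS ONLY (no definition, no named
fact, no instance, no notation, no `sorry`).  Cell `pub/hodgecm-mathlib`, ENGINE T1 (crux H413 = `stmt-HodgeConjecture-24833`), row O7
«singular semisimple classes» (A-p01 CENSUS-O7 v3 §3): FILE A of (P1-s) — the local classification that (P1-s) «same block-determinant
class ⇒ `U(H)(F_v)`-conjugate» and (P2-s) consume.  The tree's rank-2 lemmas (★ `exists_formCongr_map_eq_map_of_anisotropic`, the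
isotropy lemmas ★ `exists_isotropic_localRing*` ∕ `exists_isotropic_localGram`) are stated for GLOBAL matrices read at `v`; the block
form `H_a · y_a` of an adelic ∕ local element has LOCAL coefficients — this file supplies the local-coefficient statements.
HC_CM is proved only modulo the printed citations until rung 0 closes.

THE MATHEMATICS.  `K` a field with an involution `σ` and `2 ≠ 0`; `h_G(x, y) = ᵗ(σx) G y` for `G ∈ M₂(K)` `σ`-hermitian.
§1 (any such `K`): a non-degenerate binary `G` has a vector with `h_G(x,x) ≠ 0` (`exists_hermForm_self_ne_zero_two`); if `G`, `G′` both
REPRESENT `1` and `det G′ = det G · σ(z) z`, then `G ≅ G′` (`exists_formCongr_eq_of_hermForm_eq_one_of_det`: both are `≅ diag(b, 1)`,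
`≅ diag(b′, 1)` by ★ `exists_formCongr_eq_diagTwo_of_hermForm_self_ne_zero`, and `b′ ∕ b` is a norm by the determinants).
§2 (`K = E_v = E ⊗_F F_v`, `E ∕ F` quadratic number fields, `σ = c ⊗ 1`, `v` finite): **every `σ`-hermitian form with LOCAL
coefficients in `m ≥ 3` variables is isotropic** (`exists_ne_zero_hermForm_self_eq_zero_of_three_le`: the trace form is an `F_v`-quadratic
form in `2m ≥ 6` variables — the standing-datum device of ★ `Liu2021.LemD1IsotropyOfPlace`, with the Gram matrix now arbitrary — and
`u(F_v) = 4`, ★ `QuadraticForms.not_anisotropic_of_five_le_finrank_adicCompletion`); hence at a NON-SPLIT `v` (`E_v` a field) every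
non-degenerate binary form REPRESENTS `1` (`exists_hermForm_self_eq_one`: apply isotropy to `G ⊕ ⟨−1⟩`; an isotropic `G` is `≅ antidiag`,
★ `exists_congr_antidiagTwo_of_isotropic`, which represents `1`), and the MAIN THEOREM **`exists_formCongr_eq_of_det_eq_mul_norm`**:
`det G′ = det G · σ(z) z`, `z ∈ E_vˣ` ⟹ `ᵗσ(T) G T = G′` for some `T ∈ GL₂(E_v)`; conversely `det_formCongr_eq_mul_norm`.

## References
* [Jacobowitz1962] R. Jacobowitz, *Hermitian forms over local fields*, Amer. J. Math. 84 (1962) 441–465, §3 Thm. 3.1.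
* [Scharlau1985HermitianForms] W. Scharlau, *Quadratic and Hermitian Forms*, Grundlehren 270 (1985), Ch. 10 §1.
* [Jacobson1940HermitianForms] N. Jacobson, *A note on hermitian forms*, Bull. AMS 46 (1940), §3 (1)(a).
* [Rogawski1990] J. Rogawski, *Automorphic representations of unitary groups in three variables* (1990), §3.8 p. 33 (`F_v^*/NE_v^*`).
-/

set_option autoImplicit false

noncomputable section

open Matrix NumberField IsDedekindDomain

namespace Literature.NumberTheory.Automorphic.UnitaryGroup

/-! ## §1 Binary hermitian forms over a field with involution -/

section Field

variable {K : Type*} [Field K] (σ : K →+* K)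

/-- **a non-degenerate binary hermitian form represents a non-zero value**: `G` `σ`-hermitian, `det G ≠ 0`, `2 ≠ 0` ⟹
`h_G(x, x) ≠ 0` for some `x` (a diagonal entry, or `x = (1, G₀₁⁻¹)` with `h(x,x) = 2` when the diagonal vanishes).
[cite: Scharlau1985HermitianForms, Ch. 10 §1] -/
theorem exists_hermForm_self_ne_zero_two (h2 : (2 : K) ≠ 0) {G : Matrix (Fin 2) (Fin 2) K} (hG : (G.map σ)ᵀ = G)
    (hGd : G.det ≠ 0) : ∃ x : Fin 2 → K, hermForm σ G x x ≠ 0 := by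
  by_cases h00 : G 0 0 ≠ 0
  · exact ⟨Pi.single 0 1, by rwa [hermForm_single_single]⟩
  by_cases h11 : G 1 1 ≠ 0
  · exact ⟨Pi.single 1 1, by rwa [hermForm_single_single]⟩
  rw [not_not] at h00 h11
  have h10 : G 1 0 = σ (G 0 1) := by
    have h := congrFun (congrFun hG 1) 0
    rw [Matrix.transpose_apply, Matrix.map_apply] at h
    exact h.symm
  have h01 : G 0 1 ≠ 0 := by
    intro h
    apply hGd
    rw [Matrix.det_fin_two, h00, h, zero_mul, zero_mul, sub_zero]
  refine ⟨![1, (G 0 1)⁻¹], ?_⟩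
  have hval : hermForm σ G ![1, (G 0 1)⁻¹] ![1, (G 0 1)⁻¹] = 2 := by
    simp only [hermForm_apply, dotProduct, Matrix.mulVec, Fin.sum_univ_two, Function.comp_apply, Matrix.cons_val_zero,
      Matrix.cons_val_one, h00, h11, h10, map_one, map_inv₀, one_mul, zero_mul, add_zero, zero_add]
    rw [mul_inv_cancel₀ h01, mul_one, inv_mul_cancel₀ ((map_ne_zero σ).2 h01)]
    norm_num
  rw [hval]
  exact h2

/-- `det !![u, 0; 0, 1] = u`. [folklore] -/
private theorem det_diag_one' (u : K) : Matrix.det !![u, 0; 0, (1 : K)] = u := by rw [Matrix.det_fin_two_of]; ring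

/-- **rescaling the first vector**: `ᵗσ(D) · diag(b, 1) · D = diag(σu · b · u, 1)` for `D = diag(u, 1)`, `u ≠ 0`. [folklore] -/
private theorem formCongr_diag_one' (b u : K) (hu : u ≠ 0) :
    formCongr σ (Matrix.GeneralLinearGroup.mkOfDetNeZero !![u, 0; 0, (1 : K)] (by rw [det_diag_one']; exact hu)) !![b, 0; 0, 1] =
      !![σ u * b * u, 0; 0, 1] := by
  ext i j
  fin_cases i <;> fin_cases j <;>
    simp [formCongr, Matrix.GeneralLinearGroup.mkOfDetNeZero, Matrix.mul_apply, Fin.sum_univ_two, Matrix.map_apply]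

/-- **Binary hermitian forms that represent `1` are classified by the determinant class** (any field with involution):
`h_G(x,x) = 1`, `h_{G′}(x′,x′) = 1`, `det G ≠ 0`, `det G′ = det G · σ(z) z` with `z ≠ 0` ⟹ `ᵗσ(T) G T = G′` for some `T ∈ GL₂(K)`.
(Both forms are `≅ diag(b, 1)` resp. `diag(b′, 1)`; `b = det G · N(det B)`, `b′ = det G′ · N(det B′)`, so `b′ = b · N(u)` and
`diag(u, 1)` finishes.) [cite: Jacobowitz1962, §3 Thm. 3.1] [cite: Scharlau1985HermitianForms, Ch. 10 §1] -/
theorem exists_formCongr_eq_of_hermForm_eq_one_of_det (hσ : ∀ s, σ (σ s) = s) {G G' : Matrix (Fin 2) (Fin 2) K}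
    (hG : (G.map σ)ᵀ = G) (hG' : (G'.map σ)ᵀ = G') (hGd : G.det ≠ 0) {x x' : Fin 2 → K} (hx : hermForm σ G x x = 1)
    (hx' : hermForm σ G' x' x' = 1) (hdet : ∃ z : K, z ≠ 0 ∧ G'.det = G.det * (σ z * z)) :
    ∃ T : GL (Fin 2) K, formCongr σ T G = G' := by
  obtain ⟨B, b, -, hB⟩ := exists_formCongr_eq_diagTwo_of_hermForm_self_ne_zero σ hσ hG hx one_ne_zero
  obtain ⟨B', b', -, hB'⟩ := exists_formCongr_eq_diagTwo_of_hermForm_self_ne_zero σ hσ hG' hx' one_ne_zero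
  obtain ⟨z, hz, hzdet⟩ := hdet
  -- determinants
  have hb : b = σ (B : Matrix (Fin 2) (Fin 2) K).det * G.det * (B : Matrix (Fin 2) (Fin 2) K).det := by
    have h := det_formCongr σ B G
    rwa [hB, det_diag_one'] at h
  have hb' : b' = σ (B' : Matrix (Fin 2) (Fin 2) K).det * G'.det * (B' : Matrix (Fin 2) (Fin 2) K).det := by
    have h := det_formCongr σ B' G'
    rwa [hB', det_diag_one'] at h
  have hBd : (B : Matrix (Fin 2) (Fin 2) K).det ≠ 0 := (Matrix.isUnits_det_units B).ne_zero
  have hB'd : (B' : Matrix (Fin 2) (Fin 2) K).det ≠ 0 := (Matrix.isUnits_det_units B').ne_zero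
  -- the ratio `b′ / b = N(u)`, `u := z · det B′ · (det B)⁻¹`
  set u : K := z * (B' : Matrix (Fin 2) (Fin 2) K).det * ((B : Matrix (Fin 2) (Fin 2) K).det)⁻¹ with hu
  have hu0 : u ≠ 0 := mul_ne_zero (mul_ne_zero hz hB'd) (inv_ne_zero hBd)
  have hσBd : σ (B : Matrix (Fin 2) (Fin 2) K).det ≠ 0 := (map_ne_zero σ).2 hBd
  have hbu : σ u * b * u = b' := by
    rw [hb, hb', hzdet, hu, map_mul, map_mul, map_inv₀]
    field_simp
  -- compose: `B′⁻¹ ∘ diag(u,1) ∘ B`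
  set D : GL (Fin 2) K := Matrix.GeneralLinearGroup.mkOfDetNeZero !![u, 0; 0, (1 : K)] (by rw [det_diag_one']; exact hu0) with hD
  refine ⟨B * D * B'⁻¹, ?_⟩
  rw [formCongr_mul, formCongr_mul, hB, hD, formCongr_diag_one' σ b u hu0, hbu, ← hB', formCongr_inv_formCongr]

/-- Conversely a congruence changes the determinant by a norm: `det (ᵗσ(T) G T) = det G · (σ(det T) · det T)`.
[cite: Scharlau1985HermitianForms, Ch. 10 §1] -/
theorem det_formCongr_eq_mul_norm {n : Type*} [Fintype n] [DecidableEq n] (T : GL n K) (G : Matrix n n K) :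
    (formCongr σ T G).det = G.det * (σ (T : Matrix n n K).det * (T : Matrix n n K).det) := by
  rw [det_formCongr]; ring

end Field

/-! ## §2 Local coefficients: `E_v = E ⊗_F F_v`, `σ = c ⊗ 1` -/

section Local

variable {F : Type} (E : Type) [Field F] [NumberField F] [Field E] [NumberField E] [Algebra F E]
  [Algebra.IsQuadraticExtension F E] (v : HeightOneSpectrum (𝓞 F)) (c : E ≃ₐ[F] E) {δ : E} (hcδ : c δ = -δ) (hδ : δ ≠ 0)

include hcδ hδ in
/-- **Hermitian forms with LOCAL coefficients in `m ≥ 3` variables are isotropic over `E_v`** (every finite `v`): for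
`G ∈ M_m(E_v)` `(c ⊗ 1)`-hermitian with `det G` a unit there is `x ≠ 0` with `h_G(x, x) = 0`.  The trace form `x ↦ Tr_{E_v∕F_v} h_G(x,x)`
is an `F_v`-quadratic form on `E_v^m`, `dim = 2m ≥ 6 > u(F_v) = 4`, and a zero of the trace form is a zero of `h_G` (`h_G(x,x)` is
`σ`-fixed, so `= ι_v p` with `Tr = 2p`).  [cite: Jacobson1940HermitianForms, §3 (1)(a)] [cite: Jacobowitz1962, §3 Thm. 3.1] -/
theorem exists_ne_zero_hermForm_self_eq_zero_of_three_le {m : ℕ} (hm : 3 ≤ m) {G : Matrix (Fin m) (Fin m) (LocalRing E v)}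
    (hG : (G.map (conjLocal E c v))ᵀ = G) (hGd : IsUnit G.det) :
    ∃ x : Fin m → LocalRing E v, x ≠ 0 ∧ hermForm (conjLocal E c v) G x x = 0 := by
  haveI : CharZero (v.adicCompletion F) := charZero_of_injective_algebraMap (algebraMap F _).injective
  let S : Literature.RepresentationTheory.Liu2021.OscillatorStandingData (v.adicCompletion F) (LocalRing E v) m :=
    { conj := Liu2021.LemD1OfPlace.conjAlgEquiv E v c hcδ hδ
      conj_conj := Liu2021.LemD1OfPlace.conjLocal_conjLocal_apply E v c hcδ hδ
      conj_ne_refl := Liu2021.LemD1OfPlace.conjAlgEquiv_ne_refl E v c hcδ hδ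
      gram := G
      gram_hermitian := hG
      isUnit_det_gram := hGd
      ringChar_ne_two := Liu2021.LemD1OfPlace.ringChar_adicCompletion_ne_two v
      formallyEtale := Liu2021.LemD1OfPlace.formallyEtale_localRing E v
      finrank_eq_two := finrank_localRing E v
      two_le := by omega }
  have hform : ∀ x : Fin m → LocalRing E v, S.form x x = hermForm (conjLocal E c v) G x x := fun x => rfl
  obtain ⟨Q, hQ⟩ := S.exists_quadraticForm_trace_form
  have hfin : 5 ≤ Module.finrank (v.adicCompletion F) (Fin m → LocalRing E v) :=
    Liu2021.LemD1OfPlace.five_le_finrank_pi_localRing E v hm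
  have hnot : ¬ Q.Anisotropic := QuadraticForms.not_anisotropic_of_five_le_finrank_adicCompletion F v Q hfin
  simp only [QuadraticMap.Anisotropic, not_forall] at hnot
  obtain ⟨x, hQx, hx0⟩ := hnot
  refine ⟨x, hx0, ?_⟩
  -- a zero of the trace form is a zero of the hermitian form
  have hfix : conjLocal E c v (S.form x x) = S.form x x := S.conj_form_self x
  obtain ⟨p, hp⟩ := Liu2021.LemD1OfPlace.exists_toLocalRing_eq_of_conjLocal_eq E v c hcδ hδ _ hfix
  have htr : Algebra.trace (v.adicCompletion F) (LocalRing E v) (S.form x x) = 0 := by rw [← hQ]; exact hQx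
  rw [← hp, Liu2021.LemD1OfPlace.trace_toLocalRing] at htr
  rw [← hform, ← hp, (mul_eq_zero.1 htr).resolve_left two_ne_zero, map_zero]

/-- The antidiagonal plane represents `1`: `h_{antidiag}((1, η), (1, η)) = η + σ(η) = 1` for `σ η = η`, `η + η = 1` (`η = ½`).
[folklore] -/
private theorem hermForm_antidiag_half {K : Type*} [CommRing K] (σ : K →+* K) {η : K} (hση : σ η = η) (hη : η + η = 1) :
    hermForm σ (Matrix.of fun i j : Fin 2 => if i.val + j.val + 1 = 2 then (1 : K) else 0) ![1, η] ![1, η] = 1 := by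
  simp only [hermForm_apply, dotProduct, Matrix.mulVec, Fin.sum_univ_two, Function.comp_apply, Matrix.of_apply,
    Matrix.cons_val_zero, Matrix.cons_val_one, Fin.val_zero, Fin.val_one, map_one, hση]
  norm_num
  linear_combination hη

/-- `h(a • x, a • x) = σ(a) · a · h(x, x)`. [folklore] -/
private theorem hermForm_smul_smul' {K : Type*} [CommRing K] (σ : K →+* K) {n : Type*} [Fintype n] (H : Matrix n n K)
    (a : K) (x : n → K) : hermForm σ H (a • x) (a • x) = σ a * a * hermForm σ H x x := by
  rw [hermForm_apply, hermForm_apply, Matrix.mulVec_smul, dotProduct_smul, smul_eq_mul]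
  have hcomp : (⇑σ ∘ (a • x)) = σ a • (⇑σ ∘ x) := by
    funext i
    simp only [Function.comp_apply, Pi.smul_apply, smul_eq_mul, map_mul]
  rw [hcomp, smul_dotProduct, smul_eq_mul]
  ring

/-- `h_{(−1)}(y, y) = −σ(y₀) y₀` for the `1 × 1` form `(−1)`. [folklore] -/
private theorem hermForm_negOne' {K : Type*} [CommRing K] (σ : K →+* K) (y : Fin 1 → K) :
    hermForm σ !![(-1 : K)] y y = -(σ (y 0) * y 0) := by
  simp only [hermForm_apply, dotProduct, Matrix.mulVec, Fin.sum_univ_one, Function.comp_apply, Matrix.cons_val_fin_one,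
    Matrix.of_apply]
  ring

/-- `(−1)` is `σ`-hermitian. [folklore] -/
private theorem negOne_hermitian' {K : Type*} [CommRing K] (σ : K →+* K) : ((!![(-1 : K)]).map σ)ᵀ = !![(-1 : K)] := by
  ext i j
  fin_cases i; fin_cases j
  simp

include hcδ hδ in
/-- **A non-degenerate binary hermitian form with local coefficients REPRESENTS `1` at a non-split place** (`E_v` a field):
`h_G(x, x) = 1` for some `x ∈ E_v²`.  Apply §2's isotropy to the ternary form `G ⊕ ⟨−1⟩`: a zero `(x, y)` with `y ≠ 0` gives
`h_G(y⁻¹x) = 1`; a zero with `y = 0` makes `G` isotropic, hence `≅ antidiag` (★ `exists_congr_antidiagTwo_of_isotropic`), which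
represents `1` at `(1, ½)`.  [cite: Jacobson1940HermitianForms, §3 (1)(a)] [cite: Jacobowitz1962, §3 Thm. 3.1] -/
theorem exists_hermForm_self_eq_one (w : PlacesOver E v) (hw : c • w.1 = w.1) {G : Matrix (Fin 2) (Fin 2) (LocalRing E v)}
    (hG : (G.map (conjLocal E c v))ᵀ = G) (hGd : IsUnit G.det) :
    ∃ x : Fin 2 → LocalRing E v, hermForm (conjLocal E c v) G x x = 1 := by
  haveI : CharZero (v.adicCompletion F) := charZero_of_injective_algebraMap (algebraMap F _).injective
  letI : Field (LocalRing E v) :=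
    (Liu2021.LemD1IndexedNonVacuityNonsplitPlace.isField_localRing_of_nonsplit E v c hcδ hδ w hw).toField
  have hσσ : ∀ s, conjLocal E c v (conjLocal E c v s) = s := Liu2021.LemD1OfPlace.conjLocal_conjLocal_apply E v c hcδ hδ
  have h2 : (2 : LocalRing E v) ≠ 0 := by
    rw [show (2 : LocalRing E v) = algebraMap (v.adicCompletion F) (LocalRing E v) 2 from (map_ofNat _ 2).symm]
    exact (map_ne_zero_iff _ (RingHom.injective _)).2 two_ne_zero
  -- `η = ½ ∈ ι_v(F_v)`: `σ`-fixed with `η + η = 1` (no inverse taken in the product ring `E_v`)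
  set η : LocalRing E v := toLocalRing E v (2⁻¹ : v.adicCompletion F) with hη
  have hση : conjLocal E c v η = η := by rw [hη, conjLocal_toLocalRing]
  have hηη : η + η = 1 := by
    rw [hη, ← map_add, ← map_one (toLocalRing E v)]
    congr 1
    rw [← two_mul, mul_inv_cancel₀ (two_ne_zero)]
  -- the ternary form `G ⊕ ⟨−1⟩`
  set J : Matrix (Fin (2 + 1)) (Fin (2 + 1)) (LocalRing E v) := finSum 2 1 G !![(-1 : LocalRing E v)] with hJ
  have hJh : (J.map (conjLocal E c v))ᵀ = J := by
    rw [hJ, transpose_finSum_map, hG, negOne_hermitian']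
  have hJd : IsUnit J.det := by
    rw [hJ, det_finSum, Matrix.det_fin_one_of]
    exact hGd.mul isUnit_one.neg
  obtain ⟨r, hr0, hr⟩ := exists_ne_zero_hermForm_self_eq_zero_of_three_le E v c hcδ hδ le_rfl hJh hJd
  set x : Fin 2 → LocalRing E v := fun i => r (Fin.castAdd 1 i) with hx
  set y : Fin 1 → LocalRing E v := fun j => r (Fin.natAdd 2 j) with hy
  have hrxy : Fin.append x y = r := Fin.append_castAdd_natAdd
  rw [← hrxy, hJ, hermForm_finSum_append, hermForm_negOne', ← sub_eq_add_neg, sub_eq_zero] at hr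
  by_cases hy0 : y 0 = 0
  · -- `G` is isotropic
    have hx0 : x ≠ 0 := by
      intro h0
      apply hr0
      rw [← hrxy, h0]
      funext k
      induction k using Fin.addCases with
      | left i => simp
      | right j =>
        rw [Fin.append_right, Pi.zero_apply]
        have : j = 0 := Subsingleton.elim _ _
        rw [this, hy0]
    have hiso : hermForm (conjLocal E c v) G x x = 0 := by rw [hr, hy0, mul_zero]
    obtain ⟨g, hg⟩ := Rogawski1990.exists_congr_antidiagTwo_of_isotropic (conjLocal E c v) hσσ h2 hG hGd.ne_zero hx0
      (by exact hiso)
    refine ⟨(Units.val g) *ᵥ ![1, η], ?_⟩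
    rw [hermForm_mulVec_mulVec_eq_hermForm_formCongr]
    have hfc : formCongr (conjLocal E c v) g G =
        Matrix.of fun i j : Fin 2 => if i.val + j.val + 1 = 2 then (1 : LocalRing E v) else 0 := hg
    rw [hfc]
    exact hermForm_antidiag_half (conjLocal E c v) hση hηη
  · -- rescale by an inverse `a` of `y 0` in the FIELD `E_v` (`IsField.mul_inv_cancel`; no inverse of the product ring is used)
    obtain ⟨a, ha⟩ := (Liu2021.LemD1IndexedNonVacuityNonsplitPlace.isField_localRing_of_nonsplit E v c hcδ hδ w hw).mul_inv_cancel hy0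
    refine ⟨a • x, ?_⟩
    rw [hermForm_smul_smul', hr]
    have h1 : conjLocal E c v (y 0) * conjLocal E c v a = 1 := by rw [← map_mul, ha, map_one]
    calc conjLocal E c v a * a * (conjLocal E c v (y 0) * y 0)
        = (conjLocal E c v (y 0) * conjLocal E c v a) * (y 0 * a) := by ring
      _ = 1 := by rw [h1, ha, mul_one]

include hcδ hδ in
/-- **JACOBOWITZ, RANK 2, LOCAL COEFFICIENTS — same determinant class ⇒ congruent.**  At a finite place `v` of `F` NOT split in
`E` (`w ∣ v`, `c • w = w`), two non-degenerate `(c ⊗ 1)`-hermitian matrices `G, G′ ∈ M₂(E_v)` whose determinants differ by a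
norm, `det G′ = det G · σ(z) z` with `z ∈ E_vˣ`, are congruent: `ᵗσ(T) · G · T = G′` for some `T ∈ GL₂(E_v)`.  (With the converse
`det_formCongr_eq_mul_norm`: binary hermitian forms over `E_v ∕ F_v` are classified by `det ∈ F_vˣ ∕ N(E_vˣ)`, the group of
order `2` of [Rogawski1990, §3.8].)  [cite: Jacobowitz1962, §3 Thm. 3.1] [cite: Rogawski1990, §3.8 p. 33] -/
theorem exists_formCongr_eq_of_det_eq_mul_norm (w : PlacesOver E v) (hw : c • w.1 = w.1)
    {G G' : Matrix (Fin 2) (Fin 2) (LocalRing E v)} (hG : (G.map (conjLocal E c v))ᵀ = G) (hG' : (G'.map (conjLocal E c v))ᵀ = G')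
    (hGd : IsUnit G.det) (hG'd : IsUnit G'.det)
    (hdet : ∃ z : LocalRing E v, IsUnit z ∧ G'.det = G.det * (conjLocal E c v z * z)) :
    ∃ T : GL (Fin 2) (LocalRing E v), formCongr (conjLocal E c v) T G = G' := by
  letI : Field (LocalRing E v) :=
    (Liu2021.LemD1IndexedNonVacuityNonsplitPlace.isField_localRing_of_nonsplit E v c hcδ hδ w hw).toField
  obtain ⟨x, hx⟩ := exists_hermForm_self_eq_one E v c hcδ hδ w hw hG hGd
  obtain ⟨x', hx'⟩ := exists_hermForm_self_eq_one E v c hcδ hδ w hw hG' hG'd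
  obtain ⟨z, hz, hzdet⟩ := hdet
  exact exists_formCongr_eq_of_hermForm_eq_one_of_det (conjLocal E c v) (Liu2021.LemD1OfPlace.conjLocal_conjLocal_apply E v c hcδ hδ)
    hG hG' hGd.ne_zero hx hx' ⟨z, hz.ne_zero, hzdet⟩

end Local

end Literature.NumberTheory.Automorphic.UnitaryGroup

end
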